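import Summits.QuantumFields.YangMills.Theorems.UnitScaleTiltProp7TransportedInterpolantAllMembers
import Summits.QuantumFields.YangMills.Theorems.UnitScaleTiltProp7TransportedInterpolantRowsOfRegPr
import HarnessLib

/-!
# Route `UnitScaleTilt`, crux K1 «MinimiserStabilityRegPr» (stmt-QuantumFields-19200), EX face, K-storey — **(R6b) THE TRANSPORTED INTERPOLANT AT EVERY MEMBER: THE WRAP-AROUND ROOM
# DELETED FROM THE WHOLE (K1b-a) CHAIN** — px13 ✓`Prop7TransportedInterpolant.exists_transportedInterpolant` (generic profile) → ✓`…OfRegPr.exists_transportedInterpolant_of_regPr`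
# (skew ⊗ parabola², `θ ≤ ½`) → ✓`…RowsOfRegPr.exists_transportedInterpolant_rows_of_regPr` (rows (a)(s1)(s2)) → ✓`exists_transportedInterpolant_rows_kfree` (K-free constants), each
# re-run VERBATIM with `hwrap : 2(d(ℓ−1) + 8ℓ + 1) ≤ sitesPerDir 0` DELETED and ONE supplier token swapped (root: (R6a) ✓`norm_Qk_interpolant_sub_le_allMembers`, row (a) read on the `L³`
# cover).  §3's `exists_transportedInterpolant_rows_kfree_allMembers` is px13's ✓p774605 TEXT minus `hwrap` (px12 g18 14:15:43Z ask) — px10's K6-η∕K6-Π∕K6-h133 `_allMembers` re-runs drop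
# `hwrap_of_room` and the ROOM conjunct by one token, after which the EX display rows (1) `h133` ∕ (3) `h137kπ` carry NO no-wrap room antecedent (★★OWNER g36 14:08:01Z ∕ 14:12:50Z).
# (Width seat `ym3-torus-px5` gen 15; generated from the TREE by `gen_r6b.py`.)

Cell `ym3-torus` (HUMAN RULING D-0037; rung R3 = SU(2) YM₃ on T³ — NOT d = 4, NOT infinite volume, NOT a mass gap, NOT Clay).  THEOREMS ONLY (0 `def`, 0 `sorry`, default heartbeats);
`--supports stmt-QuantumFields-19200 --as helper`; count-neutral.

WHAT IS PROVED (ns `Summit.QuantumFields.YangMills.Theorems.Prop7TransportedInterpolantRowsAllMembers`; statements = the tree's with `hwrap` deleted, binders otherwise IDENTICAL and in the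
same order, the explicit formula ∕ `θ` ∕ `C₁` ∕ `C_D` IDENTICAL).
* §1 ★★★ `exists_transportedInterpolant_allMembers` — generic profile: `∃ E`, (formula) ∧ (a) ∧ (s1).
* §2 ★★★ `exists_transportedInterpolant_of_regPr_allMembers` — skew ⊗ parabola²: (formula) ∧ `‖Q_k(U₀)(E c) − c‖ ≤ ½‖c‖` ∧ `‖E c‖ ≤ 45·√(c₀ℓ³∕cB)·‖c‖`.
* §3 ★★★ `exists_transportedInterpolant_rows_of_regPr_allMembers` (rows (a)(s1)(s2), explicit `C_D`) · ★★★ `exists_transportedInterpolant_rows_kfree_allMembers` (K-free `C_D ≤ 33·10⁸·((c₀∕cB)ℓ³)`).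
HYP-SAT (★★OWNER RULING №42).  Exactly px13's hypotheses minus the room: `RegPr F n K ε₀ U₀`, `10¹⁰L⁶ε₀ ≤ 1`, `10¹²L³ε₀ ≤ 1`, `n < K` (resp. the profile letters `OWN > 0`, `T ≠ 0` in §1);
conclusions are the same explicit `∃ E` packages; no `Prop` placeholder.
HONEST SCOPE.  Mechanical re-runs of landed proofs over (R6a); nothing of K6, (K1b), `h133`, EX `stub_existenceMinimalOrbit`, 19200 or the rung is proved here; the Yang–Mills mass gap is NOT proved.

References: T. Bałaban, CMP **99** (1985) 389–434 [Balaban1985BackgroundPropagators] ((3.13)–(3.16) p.393, (3.126)–(3.132) pp.420–422); CMP **95** (1984) 17–40 [Balaban1984PropagatorsI]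
((1.18) p.20, (1.47)–(1.50) p.26); CMP **100** (1985) [Balaban1985RegularSpaces] (Lemma 1 (1.25) p.79); CMP **102** (1985) 277–309 [Balaban1985Variational] ((6) p.278).
-/

set_option autoImplicit false

noncomputable section

open scoped BigOperators Matrix.Norms.L2Operator Matrix

namespace Summit.QuantumFields.YangMills.Theorems.Prop7TransportedInterpolantRowsAllMembers

open Literature.MathematicalPhysics.QuantumFieldTheory.Balaban1983to89
open Literature.MathematicalPhysics.QuantumFieldTheory.Balaban1983to89.T3ContinuumYM3Torus
open Finset T4Continuum BlockAveraging LatticeFieldCalculus B1RG242Torus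
open B5Eq118OneStroke (iterBlockOf)
open B7Prop1Explicit (U1)
open B7Eq78Linearization (conjR conjR_apply conjR_add conjR_smul conjR_smul_real)
open B8Ineq132 (conjR_conjR one_conjR)
open B9Eq311L2Pairing (WL2)
open B10Eq27TorusAxialLog (axialT axialT_self unitsField toUField suIncl)
open B11Eq103H1Complex (BondL2K)
open B15DeterminingSets (embIter)
open T3LevelShift (bondShift)
open T3PrintedRegularOrbits (sites_eq)
open T3PrintedRegularMinimiser (RegPr)
open T3RegularMinimiser (regThreshold regThreshold_pos)
open T3SectALandauChart (eta eta_pos)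
open Summit.QuantumFields.YangMills.Theorems.Prop7SectET3Transport (periodsT3)
open Summit.QuantumFields.YangMills.Theorems.Prop7SectET3HilbertLetters (W₂ toL2 toL2B)
open Summit.QuantumFields.YangMills.Theorems.Prop7SectET3CurvedPropagators (Qk)
open Summit.QuantumFields.YangMills.Theorems.Prop7SymAvgTwSym (QTwS)
open Summit.QuantumFields.YangMills.Theorems.Prop7LaplaceAFlatLetters (norm_sq_toL2 norm_sq_toL2B)
open Summit.QuantumFields.YangMills.Theorems.Prop7TransportedBumpFlatRow (pbond_eq_iff frameField_mem_U1 eta_smul_conjR_QTwS_one_gauged_bump_apply normSq_Qk_bump_sub_flat_le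
  symm_Qk_bump_apply_eq_zero_of_not_read flat_bump_apply_eq_zero_of_not_read)
open Summit.QuantumFields.YangMills.Theorems.Prop7TransportedBumpNorms (sum_normSq_sum_le_of_support card_filter_src_or_le axialFrame_mem_U1 normSq_toL2_interpolant normSq_toL2B_spillShift
  bump_sum_apply sum_normSq_toL2_bump)
open B7Eq78Linearization (conjR)
open B10Eq27TorusAxialLog (axialT unitsField toUField suIncl)
open T3SectALandauChart (eta)
open Summit.QuantumFields.YangMills.Theorems.Prop7SkewBumpProfile (skew_nonneg skew_eq_zero_of_lt skew_le sum_own_ge three_mul_sum_spill_le_sum_own)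
open Summit.QuantumFields.YangMills.Theorems.Prop7CovariantBlockBumpsProfile (tau_nonneg tau_le sum_tau_eq mass_ge)
open T3SectALandauChart (eta eta_pos bgUnits formComp)
open Summit.QuantumFields.YangMills.Theorems.Prop7SectET3HilbertLetters (W₂ toL2 toL2B toL2S DL2)
open Summit.QuantumFields.YangMills.Theorems.Prop7TransportedInterpolantGradient (hED_of_formula)
open Summit.QuantumFields.YangMills.Theorems.Prop7TransportedInterpolant
open Summit.QuantumFields.YangMills.Theorems.Prop7TransportedInterpolantOfRegPr
open Summit.QuantumFields.YangMills.Theorems.Prop7TransportedInterpolantRowsOfRegPr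
open Summit.QuantumFields.YangMills.Theorems.Prop7TransportedInterpolantAllMembers (norm_Qk_interpolant_sub_le_allMembers)

variable (F : T3Family) (n K : ℕ) (h : n ≤ K) (c₀ cB : ℝ) [Fact (0 < c₀)] [Fact (0 < cB)]

/-! ## §1 ★★★ The generic-profile interpolant at every member -/

/-- ★★★ **THE TRANSPORTED INTERPOLANT AS A LINEAR MAP, WITH ITS ROWS (a) AND (s1)** (px12 g16 (K1b-a); the letters `E`, `hQE`, `hE₁` of ✓`Prop7KinvBoundOfInterpolant.norm_KinvT_le_of_interpolant_rows`
up to the numeric `θ ≤ ½`): `RegPr F n K ε₀ U₀`, the two windows, no-wrap, `OWN > 0`, `T ≠ 0` ⟹ `∃ E : WL2 →ₗ[ℂ] BondL2K` with (formula) `toL2⁻¹(E c) = A_{toL2B⁻¹c}` (for (s2), F3),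
(a) `‖Q_k(U₀)(E c) − c‖ ≤ (|SPILL|∕OWN + √(2d·ρ·(cB∕(c₀ℓ^d))·c₀m̂⁻²Ψ₂cB⁻¹))·‖c‖`, (s1) `‖E c‖² = c₀·m̂⁻²Ψ₂·cB⁻¹·‖c‖²` (`E := toL2 ∘ A ∘ toL2B⁻¹`, ★★★`norm_Qk_interpolant_sub_le`,
✓`normSq_toL2_interpolant`). [cite: Balaban1985BackgroundPropagators, (3.13)–(3.16) p.393, (3.126)–(3.132) pp.420–422; Balaban1984PropagatorsI, (1.47)–(1.50) p.26] -/
theorem exists_transportedInterpolant_allMembers {ε₀ : ℝ} (hε₀ : 0 < ε₀) (hε : 10 ^ 10 * (F.L : ℝ) ^ 6 * ε₀ ≤ 1) (hε12 : 10 ^ 12 * (F.L : ℝ) ^ 3 * ε₀ ≤ 1)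
    (U₀ : GaugeField (F.P K) 0 (Matrix.specialUnitaryGroup (Fin 2) ℂ)) (hreg : RegPr F n K ε₀ U₀) (p τ : ℕ → ℝ)
    (hOWN : 0 < ∑ s ∈ range ((F.P K).L ^ (K - n)), ((s : ℝ) + 1) * p s) (hT : (∑ a ∈ range ((F.P K).L ^ (K - n)), τ a) ≠ 0)
    :
    ∃ E : WL2 ℂ (fun _ : PBond (F.P n) 0 => cB) W₂ →ₗ[ℂ] BondL2K ℂ 3 (periodsT3 F K) c₀ W₂,
      (∀ (c : WL2 ℂ (fun _ : PBond (F.P n) 0 => cB) W₂) (b : PBond (F.P K) 0), (toL2 F K c₀).symm (E c) b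
          = (fun b : PBond (F.P K) 0 =>
        (p ((b.src b.dir).val % (F.P K).L ^ (K - n)) * ∏ ν ∈ univ.erase b.dir, τ ((b.src ν).val % (F.P K).L ^ (K - n)))
          • conjR (Unitary.toUnits (suIncl ((axialT U₀ (Site.fibreSite 0 (K - n) (iterBlockOf (K - n) b.src) fun _ => (⟨0, pow_pos (F.P K).L_pos (K - n)⟩ : Fin ((F.P K).L ^ (K - n))))) b.src)))⁻¹
              ((((∑ s ∈ range ((F.P K).L ^ (K - n)), ((s : ℝ) + 1) * p s) * (∑ a ∈ range ((F.P K).L ^ (K - n)), τ a) ^ ((F.P K).d - 1)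
                  * ((((F.P K).L : ℝ) ^ ((F.P K).d + 1)) ^ (K - n))⁻¹)⁻¹)
                • conjR (axialT (unitsField (toUField U₀)) (Site.fibreSite 0 (K - n) (iterBlockOf (K - n) b.src) fun _ => (⟨0, pow_pos (F.P K).L_pos (K - n)⟩ : Fin ((F.P K).L ^ (K - n)))) (embIter (K - n) (iterBlockOf (K - n) b.src)))
                  ((toL2B F n cB).symm c ((bondShift (sites_eq F n K h)).symm ⟨iterBlockOf (K - n) b.src, b.dir⟩)))) b)
      ∧ (∀ c : WL2 ℂ (fun _ : PBond (F.P n) 0 => cB) W₂, ‖Qk F n K h c₀ cB U₀ (E c) - c‖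
          ≤ (|∑ s ∈ range ((F.P K).L ^ (K - n)), ((((F.P K).L ^ (K - n) : ℕ) : ℝ) - 1 - (s : ℝ)) * p s| / (∑ s ∈ range ((F.P K).L ^ (K - n)), ((s : ℝ) + 1) * p s)
          + Real.sqrt (2 * (F.P K).d
              * (4 * (3 * 10 ^ 10 * (F.L : ℝ) ^ 10 * ε₀ ^ 2
                  + 192 * ((F.L : ℝ) ^ (K - n) * (2 * regThreshold F n K ε₀ * (((((F.P K).d * ((F.P K).L ^ (K - n) - 1) : ℕ)) : ℝ) + 7 * (F.L : ℝ) ^ (K - n)))) ^ 2))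
              * (cB / (c₀ * ((F.L : ℝ) ^ (K - n)) ^ (F.P K).d))
              * (c₀ * ((((∑ s ∈ range ((F.P K).L ^ (K - n)), ((s : ℝ) + 1) * p s) * (∑ a ∈ range ((F.P K).L ^ (K - n)), τ a) ^ ((F.P K).d - 1)
                  * ((((F.P K).L : ℝ) ^ ((F.P K).d + 1)) ^ (K - n))⁻¹)⁻¹) ^ 2
                  * ((∑ a : Fin ((F.P K).L ^ (K - n)), p a ^ 2) * (∑ a : Fin ((F.P K).L ^ (K - n)), τ a ^ 2) ^ ((F.P K).d - 1))) * cB⁻¹)))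
            * ‖c‖)
      ∧ (∀ c : WL2 ℂ (fun _ : PBond (F.P n) 0 => cB) W₂, ‖E c‖ ^ 2
          = c₀ * ((((∑ s ∈ range ((F.P K).L ^ (K - n)), ((s : ℝ) + 1) * p s) * (∑ a ∈ range ((F.P K).L ^ (K - n)), τ a) ^ ((F.P K).d - 1)
                  * ((((F.P K).L : ℝ) ^ ((F.P K).d + 1)) ^ (K - n))⁻¹)⁻¹) ^ 2
              * ((∑ a : Fin ((F.P K).L ^ (K - n)), p a ^ 2) * (∑ a : Fin ((F.P K).L ^ (K - n)), τ a ^ 2) ^ ((F.P K).d - 1)))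
            * (cB⁻¹ * ‖c‖ ^ 2)) := by
  classical
  -- the interpolant field as a function of the coarse datum
  let Afun : (PBond (F.P n) 0 → Matrix (Fin 2) (Fin 2) ℂ) → (PBond (F.P K) 0 → Matrix (Fin 2) (Fin 2) ℂ) := fun C =>
    (fun b : PBond (F.P K) 0 =>
        (p ((b.src b.dir).val % (F.P K).L ^ (K - n)) * ∏ ν ∈ univ.erase b.dir, τ ((b.src ν).val % (F.P K).L ^ (K - n)))
          • conjR (Unitary.toUnits (suIncl ((axialT U₀ (Site.fibreSite 0 (K - n) (iterBlockOf (K - n) b.src) fun _ => (⟨0, pow_pos (F.P K).L_pos (K - n)⟩ : Fin ((F.P K).L ^ (K - n))))) b.src)))⁻¹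
              ((((∑ s ∈ range ((F.P K).L ^ (K - n)), ((s : ℝ) + 1) * p s) * (∑ a ∈ range ((F.P K).L ^ (K - n)), τ a) ^ ((F.P K).d - 1)
                  * ((((F.P K).L : ℝ) ^ ((F.P K).d + 1)) ^ (K - n))⁻¹)⁻¹)
                • conjR (axialT (unitsField (toUField U₀)) (Site.fibreSite 0 (K - n) (iterBlockOf (K - n) b.src) fun _ => (⟨0, pow_pos (F.P K).L_pos (K - n)⟩ : Fin ((F.P K).L ^ (K - n)))) (embIter (K - n) (iterBlockOf (K - n) b.src)))
                  (C ((bondShift (sites_eq F n K h)).symm ⟨iterBlockOf (K - n) b.src, b.dir⟩))))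
  have hadd : ∀ C C' : PBond (F.P n) 0 → Matrix (Fin 2) (Fin 2) ℂ, Afun (C + C') = Afun C + Afun C' := by
    intro C C'
    funext b
    simp only [Afun, Pi.add_apply, conjR_add, smul_add]
  have hsmul : ∀ (a : ℂ) (C : PBond (F.P n) 0 → Matrix (Fin 2) (Fin 2) ℂ), Afun (a • C) = a • Afun C := by
    intro a C
    funext b
    simp only [Afun, Pi.smul_apply, conjR_smul, smul_comm (M := ℝ) (N := ℂ)]
  let Alin : (PBond (F.P n) 0 → Matrix (Fin 2) (Fin 2) ℂ) →ₗ[ℂ] (PBond (F.P K) 0 → Matrix (Fin 2) (Fin 2) ℂ) :=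
    { toFun := Afun, map_add' := hadd, map_smul' := hsmul }
  let E : WL2 ℂ (fun _ : PBond (F.P n) 0 => cB) W₂ →ₗ[ℂ] BondL2K ℂ 3 (periodsT3 F K) c₀ W₂ :=
    (toL2 F K c₀).toLinearMap ∘ₗ Alin ∘ₗ (toL2B F n cB).symm.toLinearMap
  have hE : ∀ c, E c = toL2 F K c₀ (Afun ((toL2B F n cB).symm c)) := fun c => rfl
  refine ⟨E, fun c b => ?_, fun c => ?_, fun c => ?_⟩
  · rw [hE, LinearEquiv.symm_apply_apply]
  · have hrow := norm_Qk_interpolant_sub_le_allMembers F n K h c₀ cB hε₀ hε hε12 U₀ hreg p τ hOWN hT ((toL2B F n cB).symm c)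
    rw [LinearEquiv.apply_symm_apply] at hrow
    rw [hE]
    exact hrow
  · have hs1 := normSq_toL2_interpolant F n K h c₀ cB U₀ p τ
      (((∑ s ∈ range ((F.P K).L ^ (K - n)), ((s : ℝ) + 1) * p s) * (∑ a ∈ range ((F.P K).L ^ (K - n)), τ a) ^ ((F.P K).d - 1)
                  * ((((F.P K).L : ℝ) ^ ((F.P K).d + 1)) ^ (K - n))⁻¹)⁻¹)
      ((toL2B F n cB).symm c)
    rw [LinearEquiv.apply_symm_apply] at hs1
    rw [hE]
    exact hs1

/-! ## §2 ★★★ The skew ⊗ parabola² interpolant at every member: `θ ≤ ½`, `C₁ ≤ 45√(c₀ℓ³∕cB)` -/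

-- HEARTBEAT rule (README): MEASURED — this re-run (like its tree original) fails at 100 000 and passes at the default 200 000; budgeted decl-locally as insurance (disclosed).
set_option maxHeartbeats 400000 in
/-- ★★★ **(K1b-a) — THE TRANSPORTED APPROXIMATE RIGHT INVERSE OF `Q_k(U₀)` ON `RegPr`, K-FREE**: `RegPr F n K ε₀ U₀`, `10¹⁰L⁶ε₀ ≤ 1`, `10¹²L³ε₀ ≤ 1`, `n < K`,
(NO wrap-around room — R6a) ⟹ `∃ E : WL2 →ₗ[ℂ] BondL2K` with (formula) `toL2⁻¹(E c)(b) = ψ(b) • Ad_{(σ_{ŷ_b}(b₋)♭)⁻¹}(m̂⁻¹ • Ad_{Φ(B^k b₋)}(toL2B⁻¹c)(e⁻¹ŷ_b))` for the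
skew ⊗ parabola² profile `ψ`, (a) `‖Q_k(U₀)(E c) − c‖ ≤ ½‖c‖`, (s1) `‖E c‖ ≤ 45·√(c₀·ℓ³∕cB)·‖c‖` (`= 45` at the pin `cB = c₀ℓ³`) — ✓`exists_transportedInterpolant` with §1–§3:
`SPILL∕OWN ≤ ⅓`, `6ρ·m̂⁻²Ψ₂∕ℓ³ ≤ 11757·ρ ≤ 11757·10⁻⁸ ≤ 1∕36`, `m̂⁻²Ψ₂ ≤ 1960·ℓ³`.  The letters `E`, `hQE` (`θ = ½`), `hE₁` of px12 ✓`Prop7KinvBoundOfInterpolant.norm_KinvT_le_of_interpolant_rows`;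
`hED` ((s2)) is the next file. [cite: Balaban1985BackgroundPropagators, (3.13)–(3.16) p.393, (3.126)–(3.132) pp.420–422; Balaban1984PropagatorsI, (1.18) p.20, (1.47)–(1.50) p.26] -/
theorem exists_transportedInterpolant_of_regPr_allMembers {ε₀ : ℝ} (hε₀ : 0 < ε₀) (hε : 10 ^ 10 * (F.L : ℝ) ^ 6 * ε₀ ≤ 1) (hε12 : 10 ^ 12 * (F.L : ℝ) ^ 3 * ε₀ ≤ 1)
    (U₀ : GaugeField (F.P K) 0 (Matrix.specialUnitaryGroup (Fin 2) ℂ)) (hreg : RegPr F n K ε₀ U₀) (hnK : n < K)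
    :
    ∃ E : WL2 ℂ (fun _ : PBond (F.P n) 0 => cB) W₂ →ₗ[ℂ] BondL2K ℂ 3 (periodsT3 F K) c₀ W₂,
      (∀ (c : WL2 ℂ (fun _ : PBond (F.P n) 0 => cB) W₂) (b : PBond (F.P K) 0), (toL2 F K c₀).symm (E c) b
          = (((((b.src b.dir).val % (F.P K).L ^ (K - n) + 1 - ((F.P K).L ^ (K - n) - ((F.P K).L ^ (K - n) / 4 + 1)) : ℕ) : ℝ) * ((((F.P K).L ^ (K - n) : ℕ) : ℝ) - (((b.src b.dir).val % (F.P K).L ^ (K - n) : ℕ) : ℝ))) * ∏ ν ∈ univ.erase b.dir, ((((b.src ν).val % (F.P K).L ^ (K - n) : ℕ) : ℝ) * ((((F.P K).L ^ (K - n) : ℕ) : ℝ) - 1 - (((b.src ν).val % (F.P K).L ^ (K - n) : ℕ) : ℝ))))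
            • conjR (Unitary.toUnits (suIncl ((axialT U₀ (Site.fibreSite 0 (K - n) (iterBlockOf (K - n) b.src) fun _ => (⟨0, pow_pos (F.P K).L_pos (K - n)⟩ : Fin ((F.P K).L ^ (K - n))))) b.src)))⁻¹
              (((∑ s ∈ range ((F.P K).L ^ (K - n)), ((s : ℝ) + 1) * (((s + 1 - ((F.P K).L ^ (K - n) - ((F.P K).L ^ (K - n) / 4 + 1)) : ℕ) : ℝ) * ((((F.P K).L ^ (K - n) : ℕ) : ℝ) - ((s : ℕ) : ℝ)))) * (∑ a ∈ range ((F.P K).L ^ (K - n)), (((a : ℕ) : ℝ) * ((((F.P K).L ^ (K - n) : ℕ) : ℝ) - 1 - ((a : ℕ) : ℝ)))) ^ ((F.P K).d - 1) * ((((F.P K).L : ℝ) ^ ((F.P K).d + 1)) ^ (K - n))⁻¹)⁻¹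
                • conjR (axialT (unitsField (toUField U₀)) (Site.fibreSite 0 (K - n) (iterBlockOf (K - n) b.src) fun _ => (⟨0, pow_pos (F.P K).L_pos (K - n)⟩ : Fin ((F.P K).L ^ (K - n)))) (embIter (K - n) (iterBlockOf (K - n) b.src)))
                  ((toL2B F n cB).symm c ((bondShift (sites_eq F n K h)).symm ⟨iterBlockOf (K - n) b.src, b.dir⟩))))
      ∧ (∀ c : WL2 ℂ (fun _ : PBond (F.P n) 0 => cB) W₂, ‖Qk F n K h c₀ cB U₀ (E c) - c‖ ≤ (1 / 2) * ‖c‖)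
      ∧ (∀ c : WL2 ℂ (fun _ : PBond (F.P n) 0 => cB) W₂, ‖E c‖ ≤ 45 * Real.sqrt (c₀ * ((F.L : ℝ) ^ (K - n)) ^ 3 / cB) * ‖c‖) := by
  classical
  have hcB : (0 : ℝ) < cB := Fact.out
  have hc₀ : (0 : ℝ) < c₀ := Fact.out
  have hd : (F.P K).d = 3 := T3Family.P_d F K
  have hL3 : 3 ≤ F.L := by obtain ⟨a, ha⟩ := F.hL.1; have := F.hL.2; omega
  have hk1 : 1 ≤ K - n := by omega
  have hℓ3 : 3 ≤ (F.P K).L ^ (K - n) :=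
    le_trans (by simpa using hL3) (Nat.pow_le_pow_right (F.P K).L_pos hk1)
  have hℓ1 : 1 ≤ (F.P K).L ^ (K - n) := le_trans (by norm_num) hℓ3
  have hℓcast : ((((F.P K).L ^ (K - n) : ℕ)) : ℝ) = (F.L : ℝ) ^ (K - n) := by push_cast; rfl
  have hℓpos : (0 : ℝ) < (F.L : ℝ) ^ (K - n) := by rw [← hℓcast]; exact_mod_cast (lt_of_lt_of_le (by norm_num) hℓ1)
  -- the one-dimensional sums of the two profiles
  have hOWN : 0 < ∑ s ∈ range ((F.P K).L ^ (K - n)), ((s : ℝ) + 1) * (fun s : ℕ => (((s + 1 - ((F.P K).L ^ (K - n) - ((F.P K).L ^ (K - n) / 4 + 1)) : ℕ) : ℝ) * ((((F.P K).L ^ (K - n) : ℕ) : ℝ) - ((s : ℕ) : ℝ)))) s := by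
    simp only []
    exact sum_own_skew_pos hℓ1
  have hT : (∑ a ∈ range ((F.P K).L ^ (K - n)), (fun m : ℕ => (((m : ℕ) : ℝ) * ((((F.P K).L ^ (K - n) : ℕ) : ℝ) - 1 - ((m : ℕ) : ℝ)))) a) ≠ 0 := by
    simp only []
    exact (sum_tau_pos hℓ3).ne'
  obtain ⟨E, hf, hQE, hE1⟩ := exists_transportedInterpolant_allMembers F n K h c₀ cB hε₀ hε hε12 U₀ hreg (fun s : ℕ => (((s + 1 - ((F.P K).L ^ (K - n) - ((F.P K).L ^ (K - n) / 4 + 1)) : ℕ) : ℝ) * ((((F.P K).L ^ (K - n) : ℕ) : ℝ) - ((s : ℕ) : ℝ)))) (fun m : ℕ => (((m : ℕ) : ℝ) * ((((F.P K).L ^ (K - n) : ℕ) : ℝ) - 1 - ((m : ℕ) : ℝ)))) hOWN hT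
  -- THE NUMBERS: sums as atoms, `d = 3`, `ℓ = L^k`
  have hS := cube_mul_sum_skew_sq_le hℓ1
  have hU := sq_mul_sum_tau_sq_sq_le hℓ3
  have hsp3 := three_mul_sum_spill_le_sum_own ((F.P K).L ^ (K - n))
  have hSPnn := sum_spill_skew_nonneg ((F.P K).L ^ (K - n))
  have hTpos := sum_tau_pos hℓ3
  have hρ := rho_le F n K hε₀ hε
  rw [← Fin.sum_univ_eq_sum_range (fun s => (((s + 1 - ((F.P K).L ^ (K - n) - ((F.P K).L ^ (K - n) / 4 + 1)) : ℕ) : ℝ) * ((((F.P K).L ^ (K - n) : ℕ) : ℝ) - ((s : ℕ) : ℝ))) ^ 2) ((F.P K).L ^ (K - n))] at hS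
  rw [← Fin.sum_univ_eq_sum_range (fun a => (((a : ℕ) : ℝ) * ((((F.P K).L ^ (K - n) : ℕ) : ℝ) - 1 - ((a : ℕ) : ℝ))) ^ 2) ((F.P K).L ^ (K - n))] at hU
  simp only [] at hOWN hT hQE hE1 hS hU
  set OWN : ℝ := ∑ s ∈ range ((F.P K).L ^ (K - n)), ((s : ℝ) + 1) * (((s + 1 - ((F.P K).L ^ (K - n) - ((F.P K).L ^ (K - n) / 4 + 1)) : ℕ) : ℝ) * ((((F.P K).L ^ (K - n) : ℕ) : ℝ) - ((s : ℕ) : ℝ))) with hOWNd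
  set SPILL : ℝ := ∑ s ∈ range ((F.P K).L ^ (K - n)), (((((F.P K).L ^ (K - n) : ℕ) : ℝ)) - 1 - (s : ℝ)) * (((s + 1 - ((F.P K).L ^ (K - n) - ((F.P K).L ^ (K - n) / 4 + 1)) : ℕ) : ℝ) * ((((F.P K).L ^ (K - n) : ℕ) : ℝ) - ((s : ℕ) : ℝ))) with hSPILLd
  set T : ℝ := ∑ a ∈ range ((F.P K).L ^ (K - n)), (((a : ℕ) : ℝ) * ((((F.P K).L ^ (K - n) : ℕ) : ℝ) - 1 - ((a : ℕ) : ℝ))) with hTd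
  set S2 : ℝ := ∑ a : Fin ((F.P K).L ^ (K - n)), ((((a : ℕ) + 1 - ((F.P K).L ^ (K - n) - ((F.P K).L ^ (K - n) / 4 + 1)) : ℕ) : ℝ) * ((((F.P K).L ^ (K - n) : ℕ) : ℝ) - (((a : ℕ) : ℕ) : ℝ))) ^ 2 with hS2d
  set U2 : ℝ := ∑ a : Fin ((F.P K).L ^ (K - n)), ((((a : ℕ) : ℕ) : ℝ) * ((((F.P K).L ^ (K - n) : ℕ) : ℝ) - 1 - (((a : ℕ) : ℕ) : ℝ))) ^ 2 with hU2d
  set ρ : ℝ := 4 * (3 * 10 ^ 10 * (F.L : ℝ) ^ 10 * ε₀ ^ 2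
      + 192 * ((F.L : ℝ) ^ (K - n) * (2 * regThreshold F n K ε₀ * (((((F.P K).d * ((F.P K).L ^ (K - n) - 1) : ℕ)) : ℝ) + 7 * (F.L : ℝ) ^ (K - n)))) ^ 2) with hρd
  have hρ0 : 0 ≤ ρ := by
    rw [hρd]; have := regThreshold_pos F (n := n) (K := K) hε₀; positivity
  have hPL : (((F.P K).L : ℕ) : ℝ) = (F.L : ℝ) := rfl
  rw [hℓcast] at hS hU
  set ℓF : ℝ := (F.L : ℝ) ^ (K - n) with hℓFd
  have h4 : (((F.P K).L : ℝ) ^ ((F.P K).d + 1)) ^ (K - n) = ℓF ^ 4 := by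
    rw [hd, hPL, ← pow_mul, mul_comm, pow_mul]
  have hd1 : (F.P K).d - 1 = 2 := by rw [hd]
  have hd3 : ((F.P K).d : ℝ) = 3 := by rw [hd]; norm_num
  rw [h4, hd1] at hE1
  rw [h4, hd1, hd3, hd] at hQE
  have hS2nn : 0 ≤ S2 := by rw [hS2d]; exact Finset.sum_nonneg fun _ _ => sq_nonneg _
  have hU2nn : 0 ≤ U2 := by rw [hU2d]; exact Finset.sum_nonneg fun _ _ => sq_nonneg _
  have hc₀' : c₀ ≠ 0 := hc₀.ne'
  have hcB' : cB ≠ 0 := hcB.ne'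
  have hℓF' : ℓF ≠ 0 := hℓpos.ne'
  have hOWN' : OWN ≠ 0 := hOWN.ne'
  have hT' : T ≠ 0 := hTpos.ne'
  -- forget the definitions of the atoms (keeps `field_simp`∕`ring` small)
  clear_value OWN SPILL T S2 U2 ρ ℓF
  -- `(ℓ³Σp²)(ℓ²(Στ²)²) ≤ 43·OWN² · (729/16)·T⁴`
  have hP : (ℓF ^ 3 * S2) * (ℓF ^ 2 * U2 ^ 2) ≤ (43 * OWN ^ 2) * (729 / 16 * T ^ 4) := by
    have hU' : ℓF ^ 2 * U2 ^ 2 ≤ 729 / 16 * T ^ 4 := by nlinarith [hU]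
    exact mul_le_mul hS hU' (by positivity) (by positivity)
  refine ⟨E, fun c b => hf c b, fun c => (hQE c).trans (mul_le_mul_of_nonneg_right ?_ (norm_nonneg c)), fun c => ?_⟩
  · -- θ ≤ ½
    have hA : |SPILL| / OWN ≤ 1 / 3 := by
      rw [abs_of_nonneg hSPnn, div_le_iff₀ hOWN]; linarith
    have hrad : 2 * 3 * ρ * (cB / (c₀ * ℓF ^ 3)) * (c₀ * ((OWN * T ^ 2 * (ℓF ^ 4)⁻¹)⁻¹ ^ 2 * (S2 * U2 ^ 2)) * cB⁻¹) ≤ 1 / 36 := by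
      have heq : 2 * 3 * ρ * (cB / (c₀ * ℓF ^ 3)) * (c₀ * ((OWN * T ^ 2 * (ℓF ^ 4)⁻¹)⁻¹ ^ 2 * (S2 * U2 ^ 2)) * cB⁻¹)
          = 6 * ρ * ((ℓF ^ 3 * S2) * (ℓF ^ 2 * U2 ^ 2)) / (OWN ^ 2 * T ^ 4) := by
        field_simp
        ring
      rw [heq, div_le_iff₀ (by positivity)]
      calc 6 * ρ * ((ℓF ^ 3 * S2) * (ℓF ^ 2 * U2 ^ 2)) ≤ 6 * ((10 : ℝ)⁻¹ ^ 8) * ((43 * OWN ^ 2) * (729 / 16 * T ^ 4)) := by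
            gcongr
        _ = (6 * (10 : ℝ)⁻¹ ^ 8 * 43 * (729 / 16)) * (OWN ^ 2 * T ^ 4) := by ring
        _ ≤ 1 / 36 * (OWN ^ 2 * T ^ 4) := mul_le_mul_of_nonneg_right (by norm_num) (by positivity)
    calc |SPILL| / OWN + Real.sqrt (2 * 3 * ρ * (cB / (c₀ * ℓF ^ 3)) * (c₀ * ((OWN * T ^ 2 * (ℓF ^ 4)⁻¹)⁻¹ ^ 2 * (S2 * U2 ^ 2)) * cB⁻¹))
        ≤ 1 / 3 + Real.sqrt (1 / 36) := add_le_add hA (Real.sqrt_le_sqrt hrad)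
      _ = 1 / 2 := by
          rw [show (1 / 36 : ℝ) = (1 / 6) ^ 2 by norm_num, Real.sqrt_sq (by norm_num)]
          norm_num
  · -- C₁ ≤ 45 √(c₀ℓ³/cB)
    have hE := hE1 c
    have hM : c₀ * ((OWN * T ^ 2 * (ℓF ^ 4)⁻¹)⁻¹ ^ 2 * (S2 * U2 ^ 2)) * (cB⁻¹ * ‖c‖ ^ 2) ≤ (45 * Real.sqrt (c₀ * ℓF ^ 3 / cB) * ‖c‖) ^ 2 := by
      rw [mul_pow, mul_pow, Real.sq_sqrt (by positivity)]
      have hkey : (OWN * T ^ 2 * (ℓF ^ 4)⁻¹)⁻¹ ^ 2 * (S2 * U2 ^ 2) ≤ 1960 * ℓF ^ 3 := by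
        have heq : (OWN * T ^ 2 * (ℓF ^ 4)⁻¹)⁻¹ ^ 2 * (S2 * U2 ^ 2) = ℓF ^ 3 * ((ℓF ^ 3 * S2) * (ℓF ^ 2 * U2 ^ 2)) / (OWN ^ 2 * T ^ 4) := by
          field_simp
        rw [heq, div_le_iff₀ (by positivity)]
        calc ℓF ^ 3 * ((ℓF ^ 3 * S2) * (ℓF ^ 2 * U2 ^ 2)) ≤ ℓF ^ 3 * ((43 * OWN ^ 2) * (729 / 16 * T ^ 4)) :=
              mul_le_mul_of_nonneg_left hP (by positivity)
          _ = (43 * 729 / 16) * (ℓF ^ 3 * (OWN ^ 2 * T ^ 4)) := by ring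
          _ ≤ 1960 * (ℓF ^ 3 * (OWN ^ 2 * T ^ 4)) := mul_le_mul_of_nonneg_right (by norm_num) (by positivity)
          _ = 1960 * ℓF ^ 3 * (OWN ^ 2 * T ^ 4) := by ring
      calc c₀ * ((OWN * T ^ 2 * (ℓF ^ 4)⁻¹)⁻¹ ^ 2 * (S2 * U2 ^ 2)) * (cB⁻¹ * ‖c‖ ^ 2)
          ≤ c₀ * (1960 * ℓF ^ 3) * (cB⁻¹ * ‖c‖ ^ 2) := by gcongr
        _ = 1960 * ((c₀ * ℓF ^ 3 / cB) * ‖c‖ ^ 2) := by ring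
        _ ≤ 45 ^ 2 * (c₀ * ℓF ^ 3 / cB) * ‖c‖ ^ 2 := by
            have hx : 0 ≤ (c₀ * ℓF ^ 3 / cB) * ‖c‖ ^ 2 := by positivity
            linarith
    calc ‖E c‖ = Real.sqrt (‖E c‖ ^ 2) := (Real.sqrt_sq (norm_nonneg _)).symm
      _ ≤ Real.sqrt ((45 * Real.sqrt (c₀ * ℓF ^ 3 / cB) * ‖c‖) ^ 2) := Real.sqrt_le_sqrt (by rw [hE]; exact hM)
      _ = 45 * Real.sqrt (c₀ * ℓF ^ 3 / cB) * ‖c‖ := Real.sqrt_sq (by positivity)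

/-! ## §3 ★★★ All three rows, and the K-free edition, at every member -/

-- HEARTBEAT rule (README): MEASURED — this re-run (like its tree original) fails at 100 000 and passes at the default 200 000; budgeted decl-locally as insurance (disclosed).
set_option maxHeartbeats 400000 in
/-- ★★★ **(K1b-a) — ALL THREE ROWS OF THE TRANSPORTED INTERPOLANT OF `Q_k(U₀)` ON `RegPr`**: `RegPr F n K ε₀ U₀`, `10¹⁰L⁶ε₀ ≤ 1`, `10¹²L³ε₀ ≤ 1`, `n < K`, (NO wrap-around
room — R6a) ⟹ `∃ E : WL2 →ₗ[ℂ] BondL2K` with (a) `‖Q_k(U₀)(E c) − c‖ ≤ ½‖c‖`, (s1) `‖E c‖ ≤ 45·√(c₀ℓ³∕cB)·‖c‖` (✓`exists_transportedInterpolant_of_regPr`) and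
(s2) `Σ_μ‖D^η_{U₀}(toL2S (toL2⁻¹(E c))^μ)‖² ≤ C_D·‖c‖²` with the EXPLICIT `C_D = 2c₀η⁻²·B_c²·d·ℓ^d∕cB` of ★★★`hED_of_formula` at the skew ⊗ parabola² letters (`M_p = ℓ₁²`, `L_p = ℓ₁`, `M_τ = ℓ²∕4`,
`L_τ = ℓ`, `m = m̂⁻¹`; ✓`Prop7SkewBumpProfile`, ✓`Prop7CovariantBlockBumpsProfile`) — the three letters `hQE`, `hE₁`, `hED` of px12 ✓`Prop7KinvBoundOfInterpolant.norm_KinvT_le_of_interpolant_rows`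
(`θ = ½`; `C_D > 0` by inspection). [cite: Balaban1985BackgroundPropagators, (3.13)–(3.16) p.393, (3.126)–(3.132) pp.420–422; Balaban1984PropagatorsI, (1.18) p.20, (1.47)–(1.50) p.26; Balaban1985RegularSpaces, Lemma 1 (1.25) p.79] -/
theorem exists_transportedInterpolant_rows_of_regPr_allMembers {ε₀ : ℝ} (hε₀ : 0 < ε₀) (hε : 10 ^ 10 * (F.L : ℝ) ^ 6 * ε₀ ≤ 1) (hε12 : 10 ^ 12 * (F.L : ℝ) ^ 3 * ε₀ ≤ 1)
    (U₀ : GaugeField (F.P K) 0 (Matrix.specialUnitaryGroup (Fin 2) ℂ)) (hreg : RegPr F n K ε₀ U₀) (hnK : n < K)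
    :
    ∃ E : WL2 ℂ (fun _ : PBond (F.P n) 0 => cB) W₂ →ₗ[ℂ] BondL2K ℂ 3 (periodsT3 F K) c₀ W₂,
      (∀ c : WL2 ℂ (fun _ : PBond (F.P n) 0 => cB) W₂, ‖Qk F n K h c₀ cB U₀ (E c) - c‖ ≤ (1 / 2) * ‖c‖)
      ∧ (∀ c : WL2 ℂ (fun _ : PBond (F.P n) 0 => cB) W₂, ‖E c‖ ≤ 45 * Real.sqrt (c₀ * ((F.L : ℝ) ^ (K - n)) ^ 3 / cB) * ‖c‖)
      ∧ (∀ c : WL2 ℂ (fun _ : PBond (F.P n) 0 => cB) W₂,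
          ∑ μ : Fin (F.P K).d, ‖DL2 F n K c₀ U₀ (toL2S F K c₀ (formComp ((toL2 F K c₀).symm (E c)) μ))‖ ^ 2
            ≤ (2 * c₀ * ((eta F n K)⁻¹ ^ 2 * ((|((∑ s ∈ range ((F.P K).L ^ (K - n)), ((s : ℝ) + 1) * (((s + 1 - ((F.P K).L ^ (K - n) - ((F.P K).L ^ (K - n) / 4 + 1)) : ℕ) : ℝ) * ((((F.P K).L ^ (K - n) : ℕ) : ℝ) - ((s : ℕ) : ℝ)))) * (∑ a ∈ range ((F.P K).L ^ (K - n)), (((a : ℕ) : ℝ) * ((((F.P K).L ^ (K - n) : ℕ) : ℝ) - 1 - ((a : ℕ) : ℝ)))) ^ ((F.P K).d - 1) * ((((F.P K).L : ℝ) ^ ((F.P K).d + 1)) ^ (K - n))⁻¹)⁻¹| * (2 * (((((F.P K).L ^ (K - n) / 4 + 1 : ℕ) : ℝ)) ^ 2 * (((((F.P K).L ^ (K - n) : ℕ) : ℝ)) ^ 2 / 4) ^ ((F.P K).d - 1)) * (2 * ((3 : ℝ) * ((F.L : ℝ) ^ (K - n) - 1)) * regThreshold F n K ε₀)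
          + (((((F.P K).L ^ (K - n) / 4 + 1 : ℕ) : ℝ)) * (((((F.P K).L ^ (K - n) : ℕ) : ℝ)) ^ 2 / 4) ^ ((F.P K).d - 1) + ((((F.P K).L ^ (K - n) / 4 + 1 : ℕ) : ℝ)) ^ 2 * ((((F.P K).L ^ (K - n) : ℕ) : ℝ)) * (((((F.P K).L ^ (K - n) : ℕ) : ℝ)) ^ 2 / 4) ^ ((F.P K).d - 2)) + ((((F.P K).L ^ (K - n) / 4 + 1 : ℕ) : ℝ)) * (((((F.P K).L ^ (K - n) : ℕ) : ℝ)) ^ 2 / 4) ^ ((F.P K).d - 1))) ^ 2 * (F.P K).d * ((((F.P K).L ^ (F.P K).d) ^ (K - n) : ℕ) : ℝ))) * cB⁻¹)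
              * ‖c‖ ^ 2) := by
  have hℓ3 : 3 ≤ (F.P K).L ^ (K - n) := by
    have hL3 : 3 ≤ F.L := by obtain ⟨a, ha⟩ := F.hL.1; have := F.hL.2; omega
    exact le_trans (by simpa using hL3) (Nat.pow_le_pow_right (F.P K).L_pos (by omega : 1 ≤ K - n))
  obtain ⟨E, hf, hQE, hE1⟩ := exists_transportedInterpolant_of_regPr_allMembers F n K h c₀ cB hε₀ hε hε12 U₀ hreg hnK
  refine ⟨E, hQE, hE1, ?_⟩
  -- the letters of the skew and parabola profiles
  have hp0 : (fun s : ℕ => (((s + 1 - ((F.P K).L ^ (K - n) - ((F.P K).L ^ (K - n) / 4 + 1)) : ℕ) : ℝ) * ((((F.P K).L ^ (K - n) : ℕ) : ℝ) - ((s : ℕ) : ℝ)))) 0 = 0 :=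
    Prop7SkewBumpProfile.skew_eq_zero_of_lt (by omega)
  have hτ0 : (fun m : ℕ => (((m : ℕ) : ℝ) * ((((F.P K).L ^ (K - n) : ℕ) : ℝ) - 1 - ((m : ℕ) : ℝ)))) 0 = 0 := Prop7CovariantBlockBumpsProfile.tau_zero _
  have hMp : ∀ s, s < (F.P K).L ^ (K - n) → |(fun s : ℕ => (((s + 1 - ((F.P K).L ^ (K - n) - ((F.P K).L ^ (K - n) / 4 + 1)) : ℕ) : ℝ) * ((((F.P K).L ^ (K - n) : ℕ) : ℝ) - ((s : ℕ) : ℝ)))) s| ≤ ((((F.P K).L ^ (K - n) / 4 + 1 : ℕ) : ℝ)) ^ 2 := fun s hs => by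
    simp only []
    rw [abs_of_nonneg (Prop7SkewBumpProfile.skew_nonneg hs)]
    exact Prop7SkewBumpProfile.skew_le hs
  have hLp : ∀ s, s + 1 < (F.P K).L ^ (K - n) → |(fun s : ℕ => (((s + 1 - ((F.P K).L ^ (K - n) - ((F.P K).L ^ (K - n) / 4 + 1)) : ℕ) : ℝ) * ((((F.P K).L ^ (K - n) : ℕ) : ℝ) - ((s : ℕ) : ℝ)))) (s + 1) - (fun s : ℕ => (((s + 1 - ((F.P K).L ^ (K - n) - ((F.P K).L ^ (K - n) / 4 + 1)) : ℕ) : ℝ) * ((((F.P K).L ^ (K - n) : ℕ) : ℝ) - ((s : ℕ) : ℝ)))) s| ≤ ((((F.P K).L ^ (K - n) / 4 + 1 : ℕ) : ℝ)) := fun s hs => by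
    simp only []
    exact Prop7SkewBumpProfile.abs_skew_succ_sub_le hs
  have hℓ1 : 1 ≤ (F.P K).L ^ (K - n) := le_trans (by norm_num) hℓ3
  have hpl : |(fun s : ℕ => (((s + 1 - ((F.P K).L ^ (K - n) - ((F.P K).L ^ (K - n) / 4 + 1)) : ℕ) : ℝ) * ((((F.P K).L ^ (K - n) : ℕ) : ℝ) - ((s : ℕ) : ℝ)))) ((F.P K).L ^ (K - n) - 1)| ≤ ((((F.P K).L ^ (K - n) / 4 + 1 : ℕ) : ℝ)) := by
    simp only []
    rw [Prop7SkewBumpProfile.skew_last hℓ1, abs_of_nonneg (by positivity)]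
  have hτl : (fun m : ℕ => (((m : ℕ) : ℝ) * ((((F.P K).L ^ (K - n) : ℕ) : ℝ) - 1 - ((m : ℕ) : ℝ)))) ((F.P K).L ^ (K - n) - 1) = 0 := Prop7CovariantBlockBumpsProfile.tau_last hℓ1
  have hMτ : ∀ m, m < (F.P K).L ^ (K - n) → |(fun m : ℕ => (((m : ℕ) : ℝ) * ((((F.P K).L ^ (K - n) : ℕ) : ℝ) - 1 - ((m : ℕ) : ℝ)))) m| ≤ (((((F.P K).L ^ (K - n) : ℕ) : ℝ)) ^ 2 / 4) := fun m hm => by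
    simp only []
    rw [abs_of_nonneg (Prop7CovariantBlockBumpsProfile.tau_nonneg hm)]
    exact Prop7CovariantBlockBumpsProfile.tau_le m
  have hLτ : ∀ m, m + 1 < (F.P K).L ^ (K - n) → |(fun m : ℕ => (((m : ℕ) : ℝ) * ((((F.P K).L ^ (K - n) : ℕ) : ℝ) - 1 - ((m : ℕ) : ℝ)))) (m + 1) - (fun m : ℕ => (((m : ℕ) : ℝ) * ((((F.P K).L ^ (K - n) : ℕ) : ℝ) - 1 - ((m : ℕ) : ℝ)))) m| ≤ ((((F.P K).L ^ (K - n) : ℕ) : ℝ)) := fun m hm => by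
    simp only []
    exact Prop7CovariantBlockBumpsProfile.abs_tau_succ_sub_le hm
  exact hED_of_formula F n K h c₀ cB hnK hε₀ U₀ hreg.plaqSmall (fun s : ℕ => (((s + 1 - ((F.P K).L ^ (K - n) - ((F.P K).L ^ (K - n) / 4 + 1)) : ℕ) : ℝ) * ((((F.P K).L ^ (K - n) : ℕ) : ℝ) - ((s : ℕ) : ℝ)))) (fun m : ℕ => (((m : ℕ) : ℝ) * ((((F.P K).L ^ (K - n) : ℕ) : ℝ) - 1 - ((m : ℕ) : ℝ)))) hp0 hτ0 hτl hMp hLp hpl hMτ hLτ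
    (by positivity) (by positivity) (by positivity) (by positivity) (by positivity) ((∑ s ∈ range ((F.P K).L ^ (K - n)), ((s : ℝ) + 1) * (((s + 1 - ((F.P K).L ^ (K - n) - ((F.P K).L ^ (K - n) / 4 + 1)) : ℕ) : ℝ) * ((((F.P K).L ^ (K - n) : ℕ) : ℝ) - ((s : ℕ) : ℝ)))) * (∑ a ∈ range ((F.P K).L ^ (K - n)), (((a : ℕ) : ℝ) * ((((F.P K).L ^ (K - n) : ℕ) : ℝ) - 1 - ((a : ℕ) : ℝ)))) ^ ((F.P K).d - 1) * ((((F.P K).L : ℝ) ^ ((F.P K).d + 1)) ^ (K - n))⁻¹)⁻¹ E hf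

/-- ★★★ **(K1b-a) IN THE K-STOREY'S CURRENCIES** (px10 g13 (K1-fam) letter `hE`): `RegPr F n K ε₀ U₀`, the two windows, `n < K`, no-wrap ⟹
`∃ E, (‖Q_k(U₀)(E c) − c‖ ≤ ½‖c‖) ∧ (‖E c‖ ≤ 45·√((c₀∕cB)·ℓ³)·‖c‖) ∧ (Σ_μ‖D^η_{U₀}(toL2S (toL2⁻¹(E c))^μ)‖² ≤ 33·10⁸·((c₀∕cB)·ℓ³)·‖c‖²)` — `C₁ L = 45`, `C_D L = 33·10⁸`,
L-ONLY (indeed absolute): K-FREE AT THE PIN `cB = c₀ℓ³`. [cite: Balaban1985BackgroundPropagators, (3.126)–(3.132) pp.420–422; Balaban1984PropagatorsI, (1.47)–(1.50) p.26] -/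
theorem exists_transportedInterpolant_rows_kfree_allMembers {ε₀ : ℝ} (hε₀ : 0 < ε₀) (hε : 10 ^ 10 * (F.L : ℝ) ^ 6 * ε₀ ≤ 1) (hε12 : 10 ^ 12 * (F.L : ℝ) ^ 3 * ε₀ ≤ 1)
    (U₀ : GaugeField (F.P K) 0 (Matrix.specialUnitaryGroup (Fin 2) ℂ)) (hreg : RegPr F n K ε₀ U₀) (hnK : n < K)
    :
    ∃ E : WL2 ℂ (fun _ : PBond (F.P n) 0 => cB) W₂ →ₗ[ℂ] BondL2K ℂ 3 (periodsT3 F K) c₀ W₂,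
      (∀ c : WL2 ℂ (fun _ : PBond (F.P n) 0 => cB) W₂, ‖Qk F n K h c₀ cB U₀ (E c) - c‖ ≤ (1 / 2) * ‖c‖)
      ∧ (∀ c : WL2 ℂ (fun _ : PBond (F.P n) 0 => cB) W₂, ‖E c‖ ≤ 45 * Real.sqrt ((c₀ / cB) * ((F.L : ℝ) ^ (K - n)) ^ 3) * ‖c‖)
      ∧ (∀ c : WL2 ℂ (fun _ : PBond (F.P n) 0 => cB) W₂,
          ∑ μ : Fin (F.P K).d, ‖DL2 F n K c₀ U₀ (toL2S F K c₀ (formComp ((toL2 F K c₀).symm (E c)) μ))‖ ^ 2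
            ≤ 33 * 10 ^ 8 * ((c₀ / cB) * ((F.L : ℝ) ^ (K - n)) ^ 3) * ‖c‖ ^ 2) := by
  obtain ⟨E, hQE, hE1, hED⟩ := exists_transportedInterpolant_rows_of_regPr_allMembers F n K h c₀ cB hε₀ hε hε12 U₀ hreg hnK
  have hCD := CD_le_kfree F n K c₀ cB hε₀ hε hnK
  refine ⟨E, hQE, fun c => ?_, fun c => (hED c).trans (mul_le_mul_of_nonneg_right hCD (sq_nonneg _))⟩
  have h1 := hE1 c
  rwa [show c₀ * ((F.L : ℝ) ^ (K - n)) ^ 3 / cB = c₀ / cB * ((F.L : ℝ) ^ (K - n)) ^ 3 from by ring] at h1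

end Summit.QuantumFields.YangMills.Theorems.Prop7TransportedInterpolantRowsAllMembers

end
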